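import Literature.NumberTheory.EllipticCurves.KummerSequenceConnecting
import Literature.NumberTheory.GaloisRepresentations.LocalDualityTheorem
import HarnessLib

/-!
# Cassels' theorem from Poitou–Tate, global input: a `k`-torsion class of `H¹(K, E[k·d])` comes from
# `H¹(K, E[k])` when `E[k](K̄)^{Γ_K} = 0` (Bockstein / the finite Kummer sequences of Milne I §6)

Crux K4 `SignedControlAtTwo` (stmt-BirchSwinnertonDyer-20309; routes `ThetaPartnerAtTwo` /
`ResidualThetaTransportAtTwo`), line `eulerchar` v10, stub `stub_pubGreenbergPTTwo` = {Cassels, Prop. 4.12,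
`poitouTate_selmerStructure_duality ℚ`}; width seat `prover-bsd-wall-tp2-p3-w3` g6. GLOBAL half of the reduction
«Cassels ⟸ Poitou–Tate» (`Cruxes/SignedControlAtTwo/CASSELS-VIA-PT-PLAN.md` §2 step 3): Greenberg, LNM 1716, p. 121,
«if `S_{M*}(F)` is finite and `M*(F) = 0`, then `coker(γ) = 0`» — the hypothesis `M*(F) = E(F)[p] = 0` enters
EXACTLY here: it makes the level-raising maps `H¹(K, E[d]) → H¹(K, E[N])` injective, so that a test class killed by
`k` descends to level `k`.

For an elliptic curve `E = W` over a field `K` of characteristic `0` and the tree's finite Kummer sequences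
`0 → E[k] →ι E[k·d] →[k] E[d] → 0` (`WeierstrassCurve.torsion_isSES`, `torsionInclusion`, `torsionMulBy`):

* `map_torsionInclusion_injective_of_forall_fixed_eq_zero` — **`ι_* : H¹(K, E[d]) → H¹(K, E[N])` is injective
  when `E[N/d](K̄)^{Γ_K} = 0`** (exactness `E[k]^Γ →δ₀ H¹(E[d]) →ι_* H¹(E[d·k])`, tree
  `IsSES.exists_δ₀_eq_of_map_one_eq_zero`);
* `map_torsionInclusion_map_torsionMulBy` — `ι_* ∘ [k]_* = k` on `H¹(K, E[k·d])`;
* **`exists_map_torsionInclusion_eq_of_nsmul_eq_zero`** — if `k • c = 0` for `c ∈ H¹(K, E[k·d])` and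
  `E[k](K̄)^{Γ_K} = 0`, then `c = ι_* z` for some `z ∈ H¹(K, E[k])` (exactness at `H¹(E[k·d])`, tree
  `IsSES.exists_map_one_eq_of_map_one_eq_zero`, after `[k]_* c = 0` by the first two items).

Levels are typed `k * d` as in `torsion_isSES`; the variants with a named top level `N = k·d` / `N = d·k`
(`…_of_eq`) are what the assembly uses (`k = p^{e'}`, `d = p^n`, `N = p^{n+e'}`). THEOREMS ONLY (no definition,
no named fact, no `sorry`); BSD is not proved by any of this.

References: [GreenbergLNM1716] §4 Appendix, p. 121; [MilneADT2006] I §6, proof of Prop. 6.9 and Lemma 6.16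
(the sequences `0 → A_m → A_{m²} → A_m → 0`); [SerreGaloisCohomology1997] I §2.2 (the exact cohomology sequence).
-/

set_option autoImplicit false
-- the Theorems namespace of this sub repeats the summit name by design (D-0017 nested layout)
set_option linter.dupNamespace false

noncomputable section

open scoped Classical

universe u

open CategoryTheory Field Function WeierstrassCurve
open Literature.NumberTheory.EllipticCurves Literature.NumberTheory.GaloisRepresentations
open scoped ContRepresentation

namespace Summit.BirchSwinnertonDyer.BirchSwinnertonDyer.Theorems.SignedEC.CasselsPT

variable {K : Type u} [Field K] [CharZero K] (W : WeierstrassCurve K)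

/-! ## §1 Injectivity of the level-raising map `ι_* : H¹(K, E[d]) → H¹(K, E[d·k])` -/

/-- **`ι_* : H¹(K, E[d]) → H¹(K, E[d·k])` is injective when `E[k](K̄)^{Γ_K} = 0`** (`d, k ≠ 0`): a class
killed by `ι_*` is `δ₀ v` for a `Γ_K`-invariant `v ∈ E[k]` (exactness of
`E[k]^{Γ_K} →δ₀ H¹(K, E[d]) →ι_* H¹(K, E[d·k])` for `0 → E[d] → E[d·k] →[d] E[k] → 0`, tree `torsion_isSES` /
`IsSES.exists_δ₀_eq_of_map_one_eq_zero`), and `v = 0`. Greenberg p. 121 («`M*(F) = 0`»); Milne I Lemma 6.16.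
[cite: GreenbergLNM1716, §4 Appendix, p. 121] [cite: SerreGaloisCohomology1997, I §2.2] -/
theorem map_torsionInclusion_injective_of_forall_fixed_eq_zero {d k : ℤ} (hd : d ≠ 0)
    (hfix : ∀ P : geomTorsion W k, (∀ σ : absoluteGaloisGroup K, σ • P = P) → P = 0)
    (h : d ∣ d * k) :
    Injective (galoisCohomology.map (W.torsionInclusion h) 1) := by
  haveI : CompactSpace (absoluteGaloisGroup K) := absoluteGaloisGroup_compactSpace K
  have hS := W.torsion_isSES hd k
  intro x y hxy
  rw [← sub_eq_zero] at hxy ⊢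
  rw [← map_sub] at hxy
  have hz : cohomologyMap (DiscreteGaloisModule.homOfIntertwining
      (W.torsionInclusion (Dvd.intro k rfl : d ∣ d * k))) 1 (x - y) = 0 := by
    rw [DiscreteGaloisModule.cohomologyMap_homOfIntertwining]
    exact hxy
  obtain ⟨v, hv⟩ := hS.exists_δ₀_eq_of_map_one_eq_zero (x - y) hz
  have hv0 : v = 0 := by
    apply Subtype.ext
    exact hfix v.1 fun σ ↦ v.2 σ
  rw [hv0, map_zero] at hv
  exact hv.symm

/-- The same with a named top level `N = d·k`. [cite: GreenbergLNM1716, §4 Appendix, p. 121] -/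
theorem map_torsionInclusion_injective_of_forall_fixed_eq_zero_of_eq {d k N : ℤ} (hd : d ≠ 0)
    (hN : d * k = N) (hfix : ∀ P : geomTorsion W k, (∀ σ : absoluteGaloisGroup K, σ • P = P) → P = 0)
    (h : d ∣ N) :
    Injective (galoisCohomology.map (W.torsionInclusion h) 1) := by
  subst hN
  exact map_torsionInclusion_injective_of_forall_fixed_eq_zero W hd hfix h

/-! ## §2 `ι_* ∘ [k]_* = k` on `H¹(K, E[k·d])` -/

omit [CharZero K] in
/-- **`ι_* ([k]_* c) = k • c`** for `c ∈ H¹(K, E[k·d])`, `[k] : E[k·d] → E[d]`, `ι : E[d] ↪ E[k·d]`: the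
composite `E[k·d] →[k] E[d] ↪ E[k·d]` is multiplication by `k` (on cocycles). Milne I §6, proof of Prop. 6.9
(the maps `m : A_{m²} → A_m`, `A_m → A_{m²}`). [cite: MilneADT2006, Ch. I §6, proof of Prop. 6.9] -/
theorem map_torsionInclusion_map_torsionMulBy (k : ℕ) (d : ℤ) (h : d ∣ (k : ℤ) * d)
    (c : galoisCohomology (W.torsionGaloisModule ((k : ℤ) * d)) 1) :
    galoisCohomology.map (W.torsionInclusion h) 1 (galoisCohomology.map (W.torsionMulBy (k : ℤ) d) 1 c) =
      k • c := by
  -- the composite morphism of topological representations and its effect on `H¹`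
  have hcomp : galoisCohomology.map (W.torsionInclusion h) 1
      (galoisCohomology.map (W.torsionMulBy (k : ℤ) d) 1 c) =
      cohomologyMap (DiscreteGaloisModule.homOfIntertwining (W.torsionMulBy (k : ℤ) d) ≫
        DiscreteGaloisModule.homOfIntertwining (W.torsionInclusion h)) 1 c := by
    obtain ⟨φ, rfl⟩ := oneCocycleClass_surjective _ c
    rw [galoisCohomology.map_one_oneCocycleClass, galoisCohomology.map_one_oneCocycleClass,
      cohomologyMap_oneCocycleClass]
    rfl
  rw [hcomp]
  refine cohomologyMap_one_eq_nsmul _ _ k (fun P ↦ Subtype.ext ?_) c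
  change (k : ℤ) • ((P : geomTorsion W ((k : ℤ) * d)) : geomPoints W) =
    ((k • P : geomTorsion W ((k : ℤ) * d)) : geomPoints W)
  rw [AddSubmonoidClass.coe_nsmul, natCast_zsmul]

/-! ## §3 A `k`-torsion class of `H¹(K, E[k·d])` comes from `H¹(K, E[k])` -/

/-- **Level descent of torsion classes.** Let `k ≥ 1`, `d ≠ 0` and assume `E[k](K̄)^{Γ_K} = 0`. If
`c ∈ H¹(K, E[k·d])` satisfies `k • c = 0`, then `c = ι_* z` for some `z ∈ H¹(K, E[k])` (`ι : E[k] ↪ E[k·d]`).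
Proof: `[k]_* c ∈ H¹(K, E[d])` has `ι'_*([k]_* c) = k • c = 0` (`ι' : E[d] ↪ E[k·d]`,
`map_torsionInclusion_map_torsionMulBy`), and `ι'_*` is injective because its obstruction group is
`E[k](K̄)^{Γ_K} = 0` (`map_torsionInclusion_injective_of_forall_fixed_eq_zero`); so `[k]_* c = 0` and `c` lies in
the image of `ι_*` (exactness of `H¹(E[k]) → H¹(E[k·d]) → H¹(E[d])`, tree `torsion_isSES` /
`IsSES.exists_map_one_eq_of_map_one_eq_zero`). This is the step «`S_{M*}(F)` finite and `M*(F) = 0` ⟹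
`coker(γ) = 0`» of Greenberg p. 121 on the test-class side. [cite: GreenbergLNM1716, §4 Appendix, p. 121]
[cite: MilneADT2006, Ch. I §6, Lemma 6.16] -/
theorem exists_map_torsionInclusion_eq_of_nsmul_eq_zero {k : ℕ} (hk : k ≠ 0) {d : ℤ} (hd : d ≠ 0)
    (hfix : ∀ P : geomTorsion W (k : ℤ), (∀ σ : absoluteGaloisGroup K, σ • P = P) → P = 0)
    (h : (k : ℤ) ∣ (k : ℤ) * d) (c : galoisCohomology (W.torsionGaloisModule ((k : ℤ) * d)) 1)
    (hc : k • c = 0) :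
    ∃ z : galoisCohomology (W.torsionGaloisModule (k : ℤ)) 1,
      galoisCohomology.map (W.torsionInclusion h) 1 z = c := by
  haveI : CompactSpace (absoluteGaloisGroup K) := absoluteGaloisGroup_compactSpace K
  have hkZ : (k : ℤ) ≠ 0 := Int.natCast_ne_zero.mpr hk
  have hS := W.torsion_isSES hkZ d
  -- `[k]_* c = 0`
  have hkc : galoisCohomology.map (W.torsionMulBy (k : ℤ) d) 1 c = 0 := by
    have hinj := map_torsionInclusion_injective_of_forall_fixed_eq_zero_of_eq W hd (mul_comm d (k : ℤ)) hfix
      (Dvd.intro_left (k : ℤ) rfl : d ∣ (k : ℤ) * d)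
    apply hinj
    rw [map_zero, map_torsionInclusion_map_torsionMulBy W k d, hc]
  -- exactness at `H¹(E[k·d])`
  have hkc' : cohomologyMap (DiscreteGaloisModule.homOfIntertwining (W.torsionMulBy (k : ℤ) d)) 1 c = 0 := by
    rw [DiscreteGaloisModule.cohomologyMap_homOfIntertwining]; exact hkc
  obtain ⟨z, hz⟩ := hS.exists_map_one_eq_of_map_one_eq_zero c hkc'
  refine ⟨z, ?_⟩
  rw [← DiscreteGaloisModule.cohomologyMap_homOfIntertwining]
  exact hz

/-- **Level descent of torsion classes, named top level**: for `N = k·d` (`k ≥ 1`, `d ≠ 0`,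
`E[k](K̄)^{Γ_K} = 0`), every `c ∈ H¹(K, E[N])` with `k • c = 0` is `ι_* z`, `z ∈ H¹(K, E[k])`, `ι : E[k] ↪ E[N]`.
The form used by the Cassels assembly (`k = p^{e'}`, `d = p^n`, `N = p^{n+e'}`).
[cite: GreenbergLNM1716, §4 Appendix, p. 121] -/
theorem exists_map_torsionInclusion_eq_of_nsmul_eq_zero_of_eq {k : ℕ} (hk : k ≠ 0) {d N : ℤ} (hd : d ≠ 0)
    (hN : (k : ℤ) * d = N)
    (hfix : ∀ P : geomTorsion W (k : ℤ), (∀ σ : absoluteGaloisGroup K, σ • P = P) → P = 0)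
    (h : (k : ℤ) ∣ N) (c : galoisCohomology (W.torsionGaloisModule N) 1) (hc : k • c = 0) :
    ∃ z : galoisCohomology (W.torsionGaloisModule (k : ℤ)) 1,
      galoisCohomology.map (W.torsionInclusion h) 1 z = c := by
  subst hN
  exact exists_map_torsionInclusion_eq_of_nsmul_eq_zero W hk hd hfix h c hc

end Summit.BirchSwinnertonDyer.BirchSwinnertonDyer.Theorems.SignedEC.CasselsPT

end
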